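import Literature.Probability.LatticeModels.LeeYangFirstZeroMonotoneProofs
import Literature.Probability.LatticeModels.UrsellFirstZeroFromCurrents
import HarnessLib

/-!
# `CamiaJiangNewman.firstZero_antitone` holds (discharge of the named fact)

Topic `Literature/Probability/LatticeModels`; family `crit-ising`. PROOF file (theorems only: no
definition, no named fact) discharging the named fact
`Literature.Probability.LatticeModels.CamiaJiangNewman.firstZero_antitone`
(`LeeYangFirstZeroMonotone.lean`: Camia–Jiang–Newman 2023, Theorem 2 — the first real zero of
`θ ↦ ⟨cos(θ ∑_{u∈B} λ_u σ_u)⟩^{free}_{Λ;β,0}` is antitone in `β`), by composing two theorems already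
in the tree:

* `CamiaJiangNewman.firstZero_antitone_of_thm2 : CamiaJiangNewman2023_thm2 → firstZero_antitone`
  (`LeeYangFirstZeroMonotoneProofs.lean`: generalised Lee–Yang theorem, parity, and the dictionary
  between the free zero-field box and `PairIsing`), and
* `CamiaJiangNewman2023_thm2_holds : CamiaJiangNewman2023_thm2`
  (`UrsellFirstZeroFromCurrents.lean`: CJN 2023 Thm 2 in zero form, proved through the
  random-current identity at imaginary fields and Lee–Yang positivity of the pinned sine sums).

Nothing else is introduced.

## References

* [CamiaJiangNewman2023] F. Camia, J. Jiang, C. M. Newman, *Monotonicity of Ursell functions in the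
  Ising model*, CMP 401 (2023) 2459–2482, arXiv:2207.12247: Thm 2, Cor 1 (§1.2, pp. 3–4).
-/

noncomputable section

namespace Literature.Probability.LatticeModels

namespace CamiaJiangNewman

/-- **Camia–Jiang–Newman 2023, Theorem 2 (route form) holds**: for `0 ≤ β ≤ β'`, nonnegative
weights `λ` on `B ⊆ Λ`, free boundary condition and zero field, every positive real zero `θ` of
`θ ↦ ⟨cos(θ ∑_{u∈B} λ_u σ_u)⟩_{Λ;β,0}` bounds from above some positive real zero `θ'` of
`θ' ↦ ⟨cos(θ' ∑_{u∈B} λ_u σ_u)⟩_{Λ;β',0}` ("`α₁(𝐉) ≥ α₁(𝐉̃)`"). One-line discharge of the named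
fact `firstZero_antitone` from `firstZero_antitone_of_thm2` and `CamiaJiangNewman2023_thm2_holds`.
[cite: CamiaJiangNewman2023, Theorem 2 and Corollary 1 (arXiv:2207.12247 §1.2)] -/
theorem firstZero_antitone_holds : firstZero_antitone :=
  firstZero_antitone_of_thm2 CamiaJiangNewman2023_thm2_holds

end CamiaJiangNewman

end Literature.Probability.LatticeModels

end
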